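import Summits.HodgeConjecture.HodgeConjecture.Theorems.Ring2HypothesesDescentAbsolutePrimitive
import HarnessLib

/-!
# Ring 2 — hypotheses layer, descent axis: ROW b06 AND ITS PARENT NODE ARE THEIR LEFSCHETZ-PRIMITIVE FORMS
# (modulo (N)+(E)+(c)); the codimension-2 cell; the moduli are nested on abelian varieties

HONEST FRAMING (page 1, verbatim the cell's standing line): **research route conditional on HC_CM; not a
corollary; Q11.4-sentence-2 already refuted in dim ≥ 3.** Nothing in this file proves a case of the Hodge conjecture;
nothing discharges the binder of record b06 `Ring2.Hypotheses.AbsoluteHodgeImpliesAlgebraicAV` ("absolute Hodge classes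
on complex abelian varieties are algebraic", `Ring2HypothesesDescent.lean` :73; OPEN, `≡ HC_AV` modulo Deligne's Main
Theorem 2.11 = fact c1); the binder table's numbers do not move. `HC_CM` (`Theses.RankFourFaces.CMAbelianHodge`) does not
occur in this file; `HC_AV` occurs only inside AbelianAll part XIV's equivalence in §5 and is never asserted.

Hodge ladder STAGE 3, `BINDER-OWNERS.md` row **b06**, seat `ring2-b06` (gen 71), companion of
`Ring2HypothesesDescentAbsolutePrimitive.lean` (same gen): there the Lefschetz-primitive component `a₀` and the Lefschetz
quotient `a'` of an absolute Hodge class `a = a₀ + η ∪ a'` were shown absolute Hodge modulo (N)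
`chartConjugation_canonical`, (E) existence of conjugates and (c) = c34 `deligne1982_lefschetz_absoluteHodge_iff`
(product with one polarised curve). Peeling one primitive component at a time gives the ROW-LEVEL statements the previous
gens of this seat listed as out of reach:

* §1 PER VARIETY (`forall_absoluteHodge_algebraic_of_primitive_of_canonical`): on a smooth projective `n`-fold `X` with
  hyperplane datum `Λ`, if the `[H]`-PRIMITIVE absolute Hodge classes of codimension `2 ≤ p ≤ n/2` are algebraic, ALL
  absolute Hodge classes on `X` are algebraic — strong induction on `p` below the middle (`a = a₀ + [H] ∪ a'`, `a'` absolute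
  Hodge of codimension `p − 1`, `[H] ∪ N^{p-1} ⊆ Nᵖ`; corners `p ≤ 1` Lefschetz (1,1)), then gen 68's transfer (T↓) above it.
* §2 THE PARENT NODE: `AbsoluteHodgeImpliesAlgebraic ↔` "every Lefschetz-primitive absolute Hodge class of codimension
  `2 ≤ p ≤ n/2` on every smooth projective complex variety, for every polarisation class, is algebraic"
  (`absoluteHodgeImpliesAlgebraic_iff_primitive_of_canonical`) — Charles–Schnell Conj. 11.2.18 reduced to primitive classes.
* §3 ROW b06: `AbsoluteHodgeImpliesAlgebraicAV ↔` the same on complex abelian varieties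
  (`absoluteHodgeImpliesAlgebraicAV_iff_primitive_of_canonical`), and — through gen 69's middle-degree slice — on
  EVEN-dimensional abelian varieties only (`…_iff_even_primitive_of_canonical`): **the absolute twin of AbelianAll part
  XIV's `HC_AV_iff_forall_even_mem_primitiveClasses`**, with its `¬`-form (a counterexample to row b06, if any, can be taken
  Lefschetz-primitive on an even-dimensional abelian variety) and the (G)-keyed form.
* §4 THE CODIMENSION-2 CELL: on any smooth projective `X` of dimension `≥ 4`, "absolute Hodge classes in `H⁴` are
  algebraic" `↔` "the `[H]`-primitive ones are" (`a' ∈ H²` is handled by Lefschetz (1,1), fact-free); with gen 68's halving,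
  **row b06 up to dimension 5 `↔` the PRIMITIVE absolute Hodge classes in `H⁴` of abelian four- and fivefolds are
  algebraic** (`absoluteHodgeImpliesAlgebraicAV_dim_le_five_iff_primitive_codim_two_of_canonical`).
* §5 MODULI NESTED: granted c1 instead, row b06 `↔` the even-primitive form is AbelianAll XIV read on absolute Hodge
  classes (`absoluteHodgeImpliesAlgebraicAV_iff_even_primitive_of_deligne`), so §3 loses nothing against the c1 road.

HONEST COLUMN. Nothing is discharged; «10 · 0» unchanged; row b06, its parent, `HC_AV` are OPEN and NOT asserted; (N),
(E)/(G), (c), c1 are named facts displayed as hypotheses; no definition, no named fact, no sorry. NOT obtained: the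
primitive-AND-MIDDLE form of row b06 (absolute twin of AbelianAll XXVIII / row b05's defect induction) — ring2-b02's
one-step primitive lift `L pr₁^*c − (r+1)·(c ⊠ K_E)` of a primitive absolute Hodge class of LOW degree is not known to be
absolute Hodge with the tree's tools (it is for the SECOND primitive component of an absolute Hodge class, not for a
given primitive class; see the companion file's honest column: `η ∪ c` for primitive `c` below degree `n − 1` is the
residual). In print everything here follows from Charles–Schnell Prop. 11.2.7 / 11.2.8 (1); the point is that the tree's
Cor. 11.2.12 = Deligne Ex. 2.1 (c) already suffices.

References (bib keys): Deligne1982HodgeCycles (§2 Ex. 2.1 (c), (d) p. 16; Intro p. 4), CharlesSchnell2014Notes (Def. 11.2.3,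
Prop. 11.2.7–11.2.8, Cor. 11.2.12, Lemma 11.2.13, Conj. 11.2.18 — PDF pp. 464–474), VoisinHodgeI2002 (§6.2.3 Def. 6.24,
Thm. 6.25, Cor. 6.26, Rem. 6.27, §7.1.2, Thm. 11.30), VoisinHodgeII2003 (§9.2.4 Prop. 9.20), Andre1996Motifs (§1.1, §1.3),
Kleiman1968AlgebraicCycles (§1.4), BrosnanFangNiePearlstein2009 (§6 Lemma 48), KerrPearlstein2011 (§3.3), MoonenZarhin1999
(Thm. 0.1). -/

noncomputable section

set_option linter.dupNamespace false

open CategoryTheory AlgebraicGeometry MonoidalCategory CartesianMonoidalCategory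
open Literature.AlgebraicTopology.SingularHomology Literature.Geometry.Kaehler
open Literature.AlgebraicGeometry Literature.AlgebraicGeometry.Motives
open Literature.AlgebraicGeometry.HodgeTheory
open Summit.HodgeConjecture.HodgeConjecture.Theorems

namespace Summit.HodgeConjecture.HodgeConjecture.Ring2.Hypotheses

/-! ## §1 Per variety: the primitive absolute Hodge classes below the middle carry everything -/

section PerVariety

variable {n : ℕ} {X : SchemeOver ℂ}

/-- **BELOW THE MIDDLE, PRIMITIVE CLASSES SUFFICE** (modulo (N)+(E)+(c)). `X` smooth projective of dimension `n` with a
hard Lefschetz datum `Λ` (hyperplane class `[H]`): if every `[H]`-primitive absolute Hodge class of codimension `p` with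
`2 ≤ p`, `2p ≤ n` is algebraic, then EVERY absolute Hodge class of codimension `p` with `2p ≤ n` is algebraic. Strong
induction on `p`: `a = a₀ + [H] ∪ a'` (hard Lefschetz, `exists_mem_primitiveClasses_add_lefschetzPowTo`) with `a₀`
primitive absolute Hodge (`isAbsoluteHodgeClass_primitiveComponent_of_canonical`) and `a'` absolute Hodge of codimension
`p − 1` (`isAbsoluteHodgeClass_lefschetzQuotient_of_canonical`), so algebraic by induction (corners `p ≤ 1`: Lefschetz
(1,1), fact-free), and `[H] ∪ N^{p-1} ⊆ Nᵖ` (`HardLefschetzNFold.L_mem_algebraicClasses_of_mem`).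
[cite: Deligne1982HodgeCycles, §2 Example 2.1 (c), (d) (p. 16)] [cite: VoisinHodgeI2002, §6.2.3 Cor. 6.26 and Thm. 11.30]
[cite: VoisinHodgeII2003, §9.2.4 Prop. 9.20] -/
theorem forall_absoluteHodge_algebraic_lowerHalf_of_primitive_of_canonical (hN : chartConjugation_canonical)
    (hex : ∀ ⦃n : ℕ⦄ ⦃X : SchemeOver ℂ⦄, IsSmoothProjective n X →
      ∀ (σ : ℂ ≃+* ℂ) (p : ℕ) (c : complexBetti X (2 * p)), ∃ s, IsConjugateClass σ X (2 * p) c s)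
    (h21c : deligne1982_lefschetz_absoluteHodge_iff) (hX : IsSmoothProjective n X) (Λ : HardLefschetzNFold n X)
    (hprim : ∀ p : ℕ, 2 ≤ p → 2 * p ≤ n → ∀ c ∈ primitiveClasses Λ.hyperplaneClass n (2 * p),
      IsAbsoluteHodgeClass n X p c → c ∈ algebraicClasses X p)
    (p : ℕ) (hp : 2 * p ≤ n) (c : complexBetti X (2 * p)) (hc : IsAbsoluteHodgeClass n X p c) :
    c ∈ algebraicClasses X p := by
  induction p using Nat.strong_induction_on with
  | _ p ih =>
    by_cases h1 : p ≤ 1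
    · exact absoluteHodge_algebraic_of_codim_le_one hX h1 c hc
    · obtain ⟨r, rfl⟩ : ∃ r, p = r + 1 := ⟨p - 1, by omega⟩
      obtain ⟨j, hj⟩ : ∃ j, 2 * (r + 1) + j = n := ⟨n - 2 * (r + 1), by omega⟩
      obtain ⟨a₀, ha₀, a', ha⟩ :=
        exists_mem_primitiveClasses_add_lefschetzPowTo Λ.isPolarizationClass (rfl : r + 1 = r + 1) hj c
      have h₀ := isAbsoluteHodgeClass_primitiveComponent_of_canonical hN hex h21c hX Λ.isPolarizationClass rfl hj ha
        ha₀ hc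
      have h' := isAbsoluteHodgeClass_lefschetzQuotient_of_canonical hN hex h21c hX Λ.isPolarizationClass rfl hj ha
        ha₀ hc
      have halg' : a' ∈ algebraicClasses X r := ih r (by omega) (by omega) a' h'
      have hL := Λ.L_mem_algebraicClasses_of_mem 1 r (by omega) halg'
      rw [HardLefschetzNFold.L] at hL
      rw [ha]
      exact add_mem (hprim (r + 1) (by omega) hp a₀ ha₀ h₀) hL

/-- **ON ANY SMOOTH PROJECTIVE `X`: if the `[H]`-primitive absolute Hodge classes of codimension `2 ≤ p ≤ n/2` are
algebraic, ALL absolute Hodge classes on `X` are algebraic** (modulo (N)+(E)+(c)) — the lower half by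
`forall_absoluteHodge_algebraic_lowerHalf_of_primitive_of_canonical`, the rest by gen 68's halving
(`forall_absoluteHodge_algebraic_of_lowerHalf`: transfer (T↓) above the middle, nothing beyond the dimension).
[cite: Deligne1982HodgeCycles, §2 Example 2.1 (c), (d) (p. 16)] [cite: CharlesSchnell2014Notes, Cor. 11.2.12 and Lemma 11.2.13]
[cite: VoisinHodgeI2002, §6.2.3 Cor. 6.26 and Thm. 6.25] -/
theorem forall_absoluteHodge_algebraic_of_primitive_of_canonical (hN : chartConjugation_canonical)
    (hex : ∀ ⦃n : ℕ⦄ ⦃X : SchemeOver ℂ⦄, IsSmoothProjective n X →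
      ∀ (σ : ℂ ≃+* ℂ) (p : ℕ) (c : complexBetti X (2 * p)), ∃ s, IsConjugateClass σ X (2 * p) c s)
    (h21c : deligne1982_lefschetz_absoluteHodge_iff) (hX : IsSmoothProjective n X) (Λ : HardLefschetzNFold n X)
    (hprim : ∀ p : ℕ, 2 ≤ p → 2 * p ≤ n → ∀ c ∈ primitiveClasses Λ.hyperplaneClass n (2 * p),
      IsAbsoluteHodgeClass n X p c → c ∈ algebraicClasses X p)
    (p : ℕ) (c : complexBetti X (2 * p)) (hc : IsAbsoluteHodgeClass n X p c) : c ∈ algebraicClasses X p :=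
  forall_absoluteHodge_algebraic_of_lowerHalf h21c hX
    (fun q _ hq d hd ↦ forall_absoluteHodge_algebraic_lowerHalf_of_primitive_of_canonical hN hex h21c hX Λ hprim q hq d hd)
    p c hc

end PerVariety

/-! ## §2 The parent node `AbsoluteHodgeImpliesAlgebraic` is its primitive form -/

section General

/-- **`AbsoluteHodgeImpliesAlgebraic ↔` every Lefschetz-PRIMITIVE absolute Hodge class of codimension `2 ≤ p ≤ n/2` on
every smooth projective complex `n`-fold, for every polarisation class `η`, is algebraic** (modulo (N)+(E)+(c)).
Charles–Schnell's Conjecture 11.2.18 ("absolute Hodge classes are generated by cycle classes"), reduced to primitive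
classes below the middle; neither side is asserted. [cite: CharlesSchnell2014Notes, §11.2.5 Conj. 11.2.18 and Lemma 11.2.13]
[cite: Deligne1982HodgeCycles, §2 Example 2.1 (c), (d) (p. 16)] [cite: VoisinHodgeI2002, §6.2.3 Def. 6.24 and Cor. 6.26] -/
theorem absoluteHodgeImpliesAlgebraic_iff_primitive_of_canonical (hN : chartConjugation_canonical)
    (hex : ∀ ⦃n : ℕ⦄ ⦃X : SchemeOver ℂ⦄, IsSmoothProjective n X →
      ∀ (σ : ℂ ≃+* ℂ) (p : ℕ) (c : complexBetti X (2 * p)), ∃ s, IsConjugateClass σ X (2 * p) c s)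
    (h21c : deligne1982_lefschetz_absoluteHodge_iff) :
    AbsoluteHodgeImpliesAlgebraic ↔
      ∀ ⦃n : ℕ⦄ ⦃X : SchemeOver ℂ⦄, IsSmoothProjective n X → ∀ ⦃η : complexBetti X 2⦄, IsPolarizationClass n X η →
        ∀ p : ℕ, 2 ≤ p → 2 * p ≤ n → ∀ c ∈ primitiveClasses η n (2 * p),
          IsAbsoluteHodgeClass n X p c → c ∈ algebraicClasses X p := by
  refine ⟨fun h n X hX η _ p _ _ c _ hc ↦ h hX p c hc, fun h n X hX p c hc ↦ ?_⟩
  obtain ⟨Λ⟩ := nonempty_hardLefschetzNFold_holds n X hX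
  exact forall_absoluteHodge_algebraic_of_primitive_of_canonical hN hex h21c hX Λ
    (fun q hq hq2 d hd hdA ↦ h hX Λ.isPolarizationClass q hq hq2 d hd hdA) p c hc

end General

/-! ## §3 Row b06 is its primitive form — on all, and on even-dimensional, abelian varieties -/

section Abelian

/-- **ROW b06 `↔` ITS PRIMITIVE FORM** (modulo (N)+(E)+(c)): `AbsoluteHodgeImpliesAlgebraicAV` holds iff on every
complex abelian variety `A`, for every polarisation class `η` and every `2 ≤ p ≤ dim A / 2`, the `η`-PRIMITIVE absolute
Hodge classes of codimension `p` (`P^{2p}(A, η) = ker η^{dim A − 2p + 1}`) are algebraic. Neither side is asserted.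
[cite: Deligne1982HodgeCycles, Intro (p. 4) and §2 Example 2.1 (c), (d) (p. 16)] [cite: VoisinHodgeI2002, §6.2.3 Def. 6.24 and Cor. 6.26] -/
theorem absoluteHodgeImpliesAlgebraicAV_iff_primitive_of_canonical (hN : chartConjugation_canonical)
    (hex : ∀ ⦃n : ℕ⦄ ⦃X : SchemeOver ℂ⦄, IsSmoothProjective n X →
      ∀ (σ : ℂ ≃+* ℂ) (p : ℕ) (c : complexBetti X (2 * p)), ∃ s, IsConjugateClass σ X (2 * p) c s)
    (h21c : deligne1982_lefschetz_absoluteHodge_iff) :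
    AbsoluteHodgeImpliesAlgebraicAV ↔
      ∀ (A : AbelianVariety ℂ) ⦃η : complexBetti A.X 2⦄, IsPolarizationClass A.dim A.X η →
        ∀ p : ℕ, 2 ≤ p → 2 * p ≤ A.dim → ∀ c ∈ primitiveClasses η A.dim (2 * p),
          IsAbsoluteHodgeClass A.dim A.X p c → c ∈ algebraicClasses A.X p := by
  refine ⟨fun h A η _ p _ _ c _ hc ↦ h A p c hc, fun h A p c hc ↦ ?_⟩
  have hA : IsSmoothProjective A.dim A.X := AbelianVariety.isSmoothProjective_holds (A := A)
  obtain ⟨Λ⟩ := nonempty_hardLefschetzNFold_holds A.dim A.X hA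
  exact forall_absoluteHodge_algebraic_of_primitive_of_canonical hN hex h21c hA Λ
    (fun q hq hq2 d hd hdA ↦ h A Λ.isPolarizationClass q hq hq2 d hd hdA) p c hc

/-- **ROW b06 `↔` ITS EVEN-PRIMITIVE FORM — the absolute twin of AbelianAll part XIV** (modulo (N)+(E)+(c)): row b06 holds
iff for every complex abelian variety `A` of EVEN dimension, every hard Lefschetz datum `Λ` of `A` and every
`2 ≤ p ≤ dim A / 2`, the `[H]`-primitive absolute Hodge classes of codimension `p` on `A` are algebraic. Gen 69's
middle-degree slice (`absoluteHodgeImpliesAlgebraicAV_iff_middleDegree_of_canonical`: products with elliptic curves,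
[BFNP, Lemma 48]) puts a counterexample in the middle degree of an even-dimensional `C`; §1 peels its Lefschetz components
on `C` itself. Neither side is asserted. [cite: Deligne1982HodgeCycles, §2 Example 2.1 (c), (d) (p. 16)]
[cite: BrosnanFangNiePearlstein2009, §6 Lemma 48] [cite: VoisinHodgeI2002, §6.2.3 Def. 6.24 and Cor. 6.26] -/
theorem absoluteHodgeImpliesAlgebraicAV_iff_even_primitive_of_canonical (hN : chartConjugation_canonical)
    (hex : ∀ ⦃n : ℕ⦄ ⦃X : SchemeOver ℂ⦄, IsSmoothProjective n X →
      ∀ (σ : ℂ ≃+* ℂ) (p : ℕ) (c : complexBetti X (2 * p)), ∃ s, IsConjugateClass σ X (2 * p) c s)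
    (h21c : deligne1982_lefschetz_absoluteHodge_iff) :
    AbsoluteHodgeImpliesAlgebraicAV ↔
      ∀ (A : AbelianVariety ℂ) (Λ : HardLefschetzNFold A.dim A.X) (p : ℕ), Even A.dim → 2 ≤ p → 2 * p ≤ A.dim →
        ∀ c ∈ primitiveClasses Λ.hyperplaneClass A.dim (2 * p),
          IsAbsoluteHodgeClass A.dim A.X p c → c ∈ algebraicClasses A.X p := by
  refine ⟨fun h A _ p _ _ _ c _ hc ↦ h A p c hc,
    fun h ↦ (absoluteHodgeImpliesAlgebraicAV_iff_middleDegree_of_canonical hN hex h21c).2 fun C m hm hC c hc ↦ ?_⟩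
  have hCsp : IsSmoothProjective C.dim C.X := AbelianVariety.isSmoothProjective_holds (A := C)
  obtain ⟨Λ⟩ := nonempty_hardLefschetzNFold_holds C.dim C.X hCsp
  exact forall_absoluteHodge_algebraic_lowerHalf_of_primitive_of_canonical hN hex h21c hCsp Λ
    (fun q hq hq2 d hd hdA ↦ h C Λ q ⟨m, by omega⟩ hq hq2 d hd hdA) m (by omega) c hc

/-- **The `¬`-form: a counterexample to row b06, if any, can be taken LEFSCHETZ-PRIMITIVE, of codimension
`2 ≤ p ≤ dim A / 2`, on an EVEN-dimensional abelian variety** (modulo (N)+(E)+(c)); with gen 69's `¬`-form it can ALSO be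
taken in the middle degree — but not (here) both at once. Neither side is asserted.
[cite: Deligne1982HodgeCycles, §2 Example 2.1 (c), (d) (p. 16)] [cite: KerrPearlstein2011, §3.3] -/
theorem not_absoluteHodgeImpliesAlgebraicAV_iff_exists_even_primitive_of_canonical (hN : chartConjugation_canonical)
    (hex : ∀ ⦃n : ℕ⦄ ⦃X : SchemeOver ℂ⦄, IsSmoothProjective n X →
      ∀ (σ : ℂ ≃+* ℂ) (p : ℕ) (c : complexBetti X (2 * p)), ∃ s, IsConjugateClass σ X (2 * p) c s)
    (h21c : deligne1982_lefschetz_absoluteHodge_iff) :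
    ¬ AbsoluteHodgeImpliesAlgebraicAV ↔
      ∃ (A : AbelianVariety ℂ) (Λ : HardLefschetzNFold A.dim A.X) (p : ℕ), Even A.dim ∧ 2 ≤ p ∧ 2 * p ≤ A.dim ∧
        ∃ c ∈ primitiveClasses Λ.hyperplaneClass A.dim (2 * p),
          IsAbsoluteHodgeClass A.dim A.X p c ∧ c ∉ algebraicClasses A.X p := by
  rw [absoluteHodgeImpliesAlgebraicAV_iff_even_primitive_of_canonical hN hex h21c]
  push Not
  exact Iff.rfl

/-- **Row b06 `↔` its even-primitive form, keyed to the named facts (N), (G), (c)** ((E) from Grothendieck's comparison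
fact (G) by gen 69's `exists_isConjugateClass_even_of_grothendieck`). None of (N), (G), (c) is asserted.
[cite: Deligne1982HodgeCycles, §2 Example 2.1 (c), (d) (p. 16)] [cite: CharlesSchnell2014Notes, §11.2.2 (11.2.1)–(11.2.3) and Cor. 11.2.12] -/
theorem absoluteHodgeImpliesAlgebraicAV_iff_even_primitive_of_grothendieck (hN : chartConjugation_canonical)
    (hG : grothendieck_comparison_realize_surjective) (h21c : deligne1982_lefschetz_absoluteHodge_iff) :
    AbsoluteHodgeImpliesAlgebraicAV ↔
      ∀ (A : AbelianVariety ℂ) (Λ : HardLefschetzNFold A.dim A.X) (p : ℕ), Even A.dim → 2 ≤ p → 2 * p ≤ A.dim →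
        ∀ c ∈ primitiveClasses Λ.hyperplaneClass A.dim (2 * p),
          IsAbsoluteHodgeClass A.dim A.X p c → c ∈ algebraicClasses A.X p :=
  absoluteHodgeImpliesAlgebraicAV_iff_even_primitive_of_canonical hN (exists_isConjugateClass_even_of_grothendieck hG)
    h21c

end Abelian

/-! ## §4 The codimension-2 cell: primitive classes in `H⁴` -/

section CodimTwo

variable {n : ℕ} {X : SchemeOver ℂ}

/-- **CODIMENSION 2 ON ANY SMOOTH PROJECTIVE `X` OF DIMENSION `≥ 4`: the absolute Hodge classes in `H⁴(X(ℂ); ℂ)` are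
algebraic iff the `[H]`-PRIMITIVE ones are** (modulo (N)+(E)+(c)): for `a ∈ H⁴` absolute Hodge, `a = a₀ + [H] ∪ a'` with
`a₀ ∈ P⁴(X, [H])` absolute Hodge and `a' ∈ H²(X(ℂ); ℂ)` absolute Hodge, hence ALGEBRAIC by Lefschetz (1,1) (fact-free in
the tree), and `[H] ∪ a' ∈ N²`. (For `dim X ≤ 3` both sides hold outright, `absoluteHodge_algebraic_of_dim_le_three`.)
[cite: Deligne1982HodgeCycles, §2 Example 2.1 (c), (d) (p. 16)] [cite: VoisinHodgeI2002, Thm. 11.30 and §6.2.3 Cor. 6.26]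
[cite: VoisinHodgeII2003, §9.2.4 Prop. 9.20] -/
theorem forall_absoluteHodge_algebraic_codim_two_iff_primitive_of_canonical (hN : chartConjugation_canonical)
    (hex : ∀ ⦃n : ℕ⦄ ⦃X : SchemeOver ℂ⦄, IsSmoothProjective n X →
      ∀ (σ : ℂ ≃+* ℂ) (p : ℕ) (c : complexBetti X (2 * p)), ∃ s, IsConjugateClass σ X (2 * p) c s)
    (h21c : deligne1982_lefschetz_absoluteHodge_iff) (hX : IsSmoothProjective n X) (Λ : HardLefschetzNFold n X)
    (hn : 4 ≤ n) :
    (∀ c : complexBetti X (2 * 2), IsAbsoluteHodgeClass n X 2 c → c ∈ algebraicClasses X 2) ↔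
      ∀ c ∈ primitiveClasses Λ.hyperplaneClass n (2 * 2), IsAbsoluteHodgeClass n X 2 c → c ∈ algebraicClasses X 2 := by
  refine ⟨fun h c _ hc ↦ h c hc, fun h c hc ↦ ?_⟩
  obtain ⟨j, hj⟩ : ∃ j, 2 * 2 + j = n := ⟨n - 4, by omega⟩
  obtain ⟨a₀, ha₀, a', ha⟩ :=
    exists_mem_primitiveClasses_add_lefschetzPowTo Λ.isPolarizationClass (rfl : 1 + 1 = 2) hj c
  have h₀ := isAbsoluteHodgeClass_primitiveComponent_of_canonical hN hex h21c hX Λ.isPolarizationClass rfl hj ha ha₀ hc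
  have h' := isAbsoluteHodgeClass_lefschetzQuotient_of_canonical hN hex h21c hX Λ.isPolarizationClass rfl hj ha ha₀ hc
  have hL := Λ.L_mem_algebraicClasses_of_mem 1 1 (by omega) (absoluteHodge_algebraic_of_codim_le_one hX le_rfl a' h')
  rw [HardLefschetzNFold.L] at hL
  rw [ha]
  exact add_mem (h a₀ ha₀ h₀) hL

/-- **ROW b06 UP TO DIMENSION 5 `↔` THE PRIMITIVE ABSOLUTE HODGE CLASSES IN `H⁴` OF ABELIAN FOUR- AND FIVEFOLDS ARE
ALGEBRAIC** (modulo (N)+(E)+(c)): gen 68's `absoluteHodgeImpliesAlgebraicAV_dim_le_five_iff_codim_two_of_dim_four_five`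
(dimension `≤ 5` is carried by codimension 2 on 4- and 5-folds) composed with the codimension-2 cell above. First cell
with content: an abelian FOURFOLD `A`, `c ∈ P⁴(A, [H]) = ker ([H] ∪ · : H⁴ → H⁶)` absolute Hodge. Compare RUNG b06-r4
(dimension `≤ 5` modulo Moonen–Zarhin and the Weil classes of fourfolds). Neither side is asserted.
[cite: Deligne1982HodgeCycles, §2 Example 2.1 (c), (d) (p. 16)] [cite: MoonenZarhin1999, Thm. 0.1]
[cite: VoisinHodgeI2002, §6.2.3 Def. 6.24 and Thm. 11.30] -/
theorem absoluteHodgeImpliesAlgebraicAV_dim_le_five_iff_primitive_codim_two_of_canonical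
    (hN : chartConjugation_canonical)
    (hex : ∀ ⦃n : ℕ⦄ ⦃X : SchemeOver ℂ⦄, IsSmoothProjective n X →
      ∀ (σ : ℂ ≃+* ℂ) (p : ℕ) (c : complexBetti X (2 * p)), ∃ s, IsConjugateClass σ X (2 * p) c s)
    (h21c : deligne1982_lefschetz_absoluteHodge_iff) :
    (∀ (A : AbelianVariety ℂ), A.dim ≤ 5 → ∀ (p : ℕ) (c : complexBetti A.X (2 * p)),
        IsAbsoluteHodgeClass A.dim A.X p c → c ∈ algebraicClasses A.X p) ↔
      ∀ (A : AbelianVariety ℂ) (Λ : HardLefschetzNFold A.dim A.X), 4 ≤ A.dim → A.dim ≤ 5 →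
        ∀ c ∈ primitiveClasses Λ.hyperplaneClass A.dim (2 * 2),
          IsAbsoluteHodgeClass A.dim A.X 2 c → c ∈ algebraicClasses A.X 2 := by
  rw [absoluteHodgeImpliesAlgebraicAV_dim_le_five_iff_codim_two_of_dim_four_five h21c]
  refine ⟨fun h A Λ h4 h5 c _ hc ↦ h A h4 h5 c hc, fun h A h4 h5 c hc ↦ ?_⟩
  have hA : IsSmoothProjective A.dim A.X := AbelianVariety.isSmoothProjective_holds (A := A)
  obtain ⟨Λ⟩ := nonempty_hardLefschetzNFold_holds A.dim A.X hA
  exact (forall_absoluteHodge_algebraic_codim_two_iff_primitive_of_canonical hN hex h21c hA Λ h4).2 (h A Λ h4 h5) c hc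

end CodimTwo

/-! ## §5 The moduli are nested on abelian varieties: granted c1, §3 is AbelianAll XIV read on absolute Hodge classes -/

section Nested

/-- **Granted Deligne's Main Theorem 2.11 (fact c1) instead of (N)+(E)+(c): row b06 `↔` its even-primitive form is
AbelianAll part XIV** (`HC_AV_iff_forall_even_mem_primitiveClasses`, fact-free) read on absolute Hodge classes — on an
abelian variety "absolute Hodge" and "rational of type `(p,p)`" coincide (c1 one way, Charles–Schnell Def. 11.2.3 with
`σ = id` the other), and row b06 `↔ HC_AV` (`hc_av_iff_absoluteHodgeImpliesAlgebraicAV_of_deligne`). So the even-primitive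
form of §3 is the SAME binder on both roads; c1 is NOT asserted. [cite: Deligne1982HodgeCycles, Main Thm. 2.11 (p. 19)]
[cite: CharlesSchnell2014Notes, Def. 11.2.3] [cite: VoisinHodgeI2002, §6.2.3 Def. 6.24 and Cor. 6.26] -/
theorem absoluteHodgeImpliesAlgebraicAV_iff_even_primitive_of_deligne
    (hD : deligne1982_hodgeClasses_abelianVariety_absoluteHodge) :
    AbsoluteHodgeImpliesAlgebraicAV ↔
      ∀ (A : AbelianVariety ℂ) (Λ : HardLefschetzNFold A.dim A.X) (p : ℕ), Even A.dim → 2 ≤ p → 2 * p ≤ A.dim →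
        ∀ c ∈ primitiveClasses Λ.hyperplaneClass A.dim (2 * p),
          IsAbsoluteHodgeClass A.dim A.X p c → c ∈ algebraicClasses A.X p := by
  refine ⟨fun h A _ p _ _ _ c _ hc ↦ h A p c hc, fun h ↦ ?_⟩
  rw [← hc_av_iff_absoluteHodgeImpliesAlgebraicAV_of_deligne hD]
  exact AbelianAll.HC_AV_iff_forall_even_mem_primitiveClasses.2 fun A Λ p hev hp hpA c hc hpp hprim ↦
    h A Λ p hev hp hpA c hprim (hD A p c hc hpp)

end Nested

/-! ## Audit: nothing is decided here

No theorem above concludes `AbsoluteHodgeImpliesAlgebraicAV`, `AbsoluteHodgeImpliesAlgebraic`, `HC_AV` or `HC_CM`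
outright: every statement is an equivalence between OPEN statements or an implication with an undischarged hypothesis
(`hprim`, `h`); the named facts (N) `chartConjugation_canonical`, (G) `grothendieck_comparison_realize_surjective`,
(c) `deligne1982_lefschetz_absoluteHodge_iff`, c1 `deligne1982_hodgeClasses_abelianVariety_absoluteHodge` and the
existence input (E) occur only as hypotheses. Axiom closures: the three standard axioms. -/

#print axioms Summit.HodgeConjecture.HodgeConjecture.Ring2.Hypotheses.absoluteHodgeImpliesAlgebraicAV_iff_even_primitive_of_canonical
#print axioms Summit.HodgeConjecture.HodgeConjecture.Ring2.Hypotheses.absoluteHodgeImpliesAlgebraic_iff_primitive_of_canonical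

end Summit.HodgeConjecture.HodgeConjecture.Ring2.Hypotheses

end
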